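import Mathlib
import Summits.Ventures.PercRepro2.SwOutHullSplitGTypedPred
import Summits.Ventures.PercRepro2.SwOutJunctionH1GTypedInHull

/-!
# Two independent (H1) junctions on the general doubly typed side, modulo the part where both
lie in the hull of `h` (blind cell PercRepro2, night-4 g34, 2026-08-28; proofs/NIGHT4-G34.md §4)

A region `U ∋ h`, `l ∉ U`, with TWO junctions `u₁ ≠ u₂` — no loops, not adjacent to `h` nor to each
other — each satisfying (H1) in the region without the other (`H1 ends (U ∖ {u₂}) h u₁`: every
neighbour of `u₁` is joined to `h` or lies in a component of `G[U ∖ {h, u₁, u₂}]` without a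
neighbour of `h`, and symmetrically), every other vertex of `U ∖ {h}` exempt (forced into `C_R(l)`),
in `X` (loops only), with an outside edge, or isolated.  THE ITERATED HULL SPLIT
(`card_le_g_of_hullSplit_inHull`) at `u₂` and then at `u₁` reduces the rigid counting inequality
on the side `gOutSide` of every class `(U, ξ)` to

* the classes of `U ∖ {u₂}` — single-junction regions with the junction `u₁`, where `u₂` is an
  outside vertex (g33's `rigidOK_g_of_junctionH1`);
* the in-hull parts `{u₂ ∈ hull(h)}` of the classes of `U ∖ {u₁}` — single-junction regions with
  the junction `u₂` (`rigidOK_g_of_junctionH1_inHull_set`);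
* **the part `{u₁ ∈ hull(h), u₂ ∈ hull(h)}` of the class `(U, ξ)` itself** — the one hypothesis
  (`hboth`) of **`rigidOK_g_of_twoJunctionsH1_of_bothIn`**.

Census (mining/night-4/g34/parts2j.py, esc2j.py): on every instance at `n ≤ 6` (800 instances,
flavours `F` / `X`, one random family triple) the part `{u₁, u₂ ∈ hull(h)}` satisfies Hall by itself
(449 / 449 non-empty), as do the parts by the escaping status of the junctions; the block structure
of that part is the successor's (NIGHT4-G34.md §5).
-/

namespace Summit.Ventures.PercRepro2

namespace LocRows

open Hull

variable {V : Type*} {E : Type*} [Fintype E] [DecidableEq E]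

open scoped Classical

variable {ends : E → Sym2 V} {U : Set V} {ξ : Config E} {l h u₁ u₂ : V}
  {𝓤 𝓓 𝓓'' : Set (Set V)} {X : Set V} {𝓤' : Set (Set V)} {F : V → Prop}

section Two

variable (h𝓤 : IsUpperSet 𝓤) (h𝓓 : IsLowerSet 𝓓) (h𝓓'' : IsLowerSet 𝓓'') (h𝓤' : IsUpperSet 𝓤')
  (hl : l ∉ U) (hhu₁ : h ≠ u₁) (hhu₂ : h ≠ u₂) (hloop_h : ∀ e, ends e ≠ s(h, h))
  (hloop_u₁ : ∀ e, ends e ≠ s(u₁, u₁)) (hloop_u₂ : ∀ e, ends e ≠ s(u₂, u₂))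
  (hnadj₁ : ∀ e, ends e ≠ s(h, u₁)) (hnadj₂ : ∀ e, ends e ≠ s(h, u₂))
  (hF : ∀ x, F x → ∀ S ∈ 𝓤, x ∈ S)
  (hout : ∀ x ∈ U, x ≠ h → x ≠ u₁ → x ≠ u₂ →
    F x ∨ x ∈ X ∨ (∃ e y, ends e = s(x, y) ∧ y ∉ U) ∨ (∀ e, x ∉ ends e))
  (hH1₁ : H1 ends (U \ {u₂}) h u₁) (hH1₂ : H1 ends (U \ {u₁}) h u₂)
  (hhX : h ∉ X) (hu₁X : u₁ ∉ X) (hu₂X : u₂ ∉ X)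
  (hX : ∀ x ∈ X, x ∈ U → ∀ e, x ∈ ends e → ends e = s(x, x))
include h𝓤 h𝓓 h𝓓'' h𝓤' hl hhu₁ hhu₂ hloop_h hloop_u₁ hloop_u₂ hnadj₁ hnadj₂ hF hout hH1₁ hH1₂ hhX
  hu₁X hu₂X hX

omit hhu₂ hloop_u₂ hnadj₂ hH1₂ hu₂X in
/-- The classes of `U ∖ {u₂}` are single-junction classes with the junction `u₁`: the rigid
inequality on each of them. -/
theorem card_le_g_of_twoJunctions_sdiff₂ (ξ' : Config E) {𝓔 : Set (Set E)} (h𝓔 : IsUpperSet 𝓔) :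
    ((gOutSide ends l h 𝓤 𝓓 𝓓'' X 𝓤' (U \ {u₂}) ξ').filter fun ζ =>
        redEdges ends ζ h ∈ 𝓔).card ≤
      ((gOutSide ends l h 𝓤 𝓓 𝓓'' X 𝓤' (U \ {u₂}) ξ').filter fun ζ =>
        blueEdges ends ζ h ∈ 𝓔).card := by
  refine rigidOK_g_of_junctionH1 (u := u₁) (F := F) h𝓤 h𝓓 h𝓓'' h𝓤' ?_ hhu₁ hloop_h hloop_u₁ hnadj₁
    hF ?_ hH1₁ hhX hu₁X ?_ h𝓔
  · exact fun hl' => hl hl'.1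
  · intro x hx hxh hxu₁
    rcases hout x hx.1 hxh hxu₁ (by simpa using hx.2) with hf | hxX | ⟨e, y, hey, hy⟩ | hiso
    · exact Or.inl hf
    · exact Or.inr (Or.inl hxX)
    · exact Or.inr (Or.inr (Or.inl ⟨e, y, hey, fun hy' => hy hy'.1⟩))
    · exact Or.inr (Or.inr (Or.inr hiso))
  · intro x hxX hxU e hxe
    exact hX x hxX hxU.1 e hxe

omit hhu₁ hloop_u₁ hnadj₁ hH1₁ hu₁X in
/-- The in-hull parts `{u₂ ∈ hull(h)}` of the classes of `U ∖ {u₁}` — single-junction classes with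
the junction `u₂`: the rigid inequality on each of them. -/
theorem card_le_g_of_twoJunctions_sdiff₁_inHull (ξ' : Config E) {𝓔 : Set (Set E)}
    (h𝓔 : IsUpperSet 𝓔) :
    ((gOutSide ends l h 𝓤 𝓓 𝓓'' X 𝓤' (U \ {u₁}) ξ').filter fun ζ =>
        (∀ s ∈ ({u₂} : Set V), s ∈ hull ends ζ h) ∧ redEdges ends ζ h ∈ 𝓔).card ≤
      ((gOutSide ends l h 𝓤 𝓓 𝓓'' X 𝓤' (U \ {u₁}) ξ').filter fun ζ =>
        (∀ s ∈ ({u₂} : Set V), s ∈ hull ends ζ h) ∧ blueEdges ends ζ h ∈ 𝓔).card := by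
  refine rigidOK_g_of_junctionH1_inHull_set (u := u₂) (F := F) h𝓤 h𝓓 h𝓓'' h𝓤' ?_ hhu₂ hloop_h
    hloop_u₂ hnadj₂ hF ?_ hH1₂ hhX hu₂X ?_ h𝓔
  · exact fun hl' => hl hl'.1
  · intro x hx hxh hxu₂
    rcases hout x hx.1 hxh (by simpa using hx.2) hxu₂ with hf | hxX | ⟨e, y, hey, hy⟩ | hiso
    · exact Or.inl hf
    · exact Or.inr (Or.inl hxX)
    · exact Or.inr (Or.inr (Or.inl ⟨e, y, hey, fun hy' => hy hy'.1⟩))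
    · exact Or.inr (Or.inr (Or.inr hiso))
  · intro x hxX hxU e hxe
    exact hX x hxX hxU.1 e hxe

/-- **TWO INDEPENDENT (H1) JUNCTIONS MODULO THE PART WHERE BOTH LIE IN THE HULL OF `h`**: the rigid
counting inequality on `gOutSide` of the class `(U, ξ)` follows from the inequality on its part
`{u₁ ∈ hull(h), u₂ ∈ hull(h)}` alone (`hboth`), the rest being the iterated hull split into
single-junction classes of record. -/
theorem rigidOK_g_of_twoJunctionsH1_of_bothIn
    (hboth : ∀ 𝓔 : Set (Set E), IsUpperSet 𝓔 →
      ((gOutSide ends l h 𝓤 𝓓 𝓓'' X 𝓤' U ξ).filter fun ζ =>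
          u₁ ∈ hull ends ζ h ∧ u₂ ∈ hull ends ζ h ∧ redEdges ends ζ h ∈ 𝓔).card ≤
        ((gOutSide ends l h 𝓤 𝓓 𝓓'' X 𝓤' U ξ).filter fun ζ =>
          u₁ ∈ hull ends ζ h ∧ u₂ ∈ hull ends ζ h ∧ blueEdges ends ζ h ∈ 𝓔).card)
    {𝓔 : Set (Set E)} (h𝓔 : IsUpperSet 𝓔) :
    ((gOutSide ends l h 𝓤 𝓓 𝓓'' X 𝓤' U ξ).filter fun ζ => redEdges ends ζ h ∈ 𝓔).card ≤
      ((gOutSide ends l h 𝓤 𝓓 𝓓'' X 𝓤' U ξ).filter fun ζ => blueEdges ends ζ h ∈ 𝓔).card := by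
  -- the split at `u₂`
  refine card_le_g_of_inHull_empty (fun 𝓔 h𝓔 => ?_) h𝓔
  refine card_le_g_of_hullSplit_inHull (p := u₂) (∅ : Set V) (fun ξ' _ 𝓔 h𝓔 => ?_)
    (fun 𝓔 h𝓔 => ?_) h𝓔
  · -- the classes of `U ∖ {u₂}`
    have := card_le_g_of_twoJunctions_sdiff₂ (U := U) (u₂ := u₂) h𝓤 h𝓓 h𝓓'' h𝓤' hl hhu₁ hloop_h
      hloop_u₁ hnadj₁ hF hout hH1₁ hhX hu₁X hX ξ' h𝓔
    simpa only [Set.mem_empty_iff_false, false_imp_iff, implies_true, true_and] using this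
  · -- the part `{u₂ ∈ hull(h)}`: the split at `u₁`
    have h2 := card_le_g_of_hullSplit_inHull (p := u₁) ({u₂} : Set V)
      (fun ξ' _ 𝓔 h𝓔 => card_le_g_of_twoJunctions_sdiff₁_inHull (U := U) (u₁ := u₁) h𝓤 h𝓓 h𝓓''
        h𝓤' hl hhu₂ hloop_h hloop_u₂ hnadj₂ hF hout hH1₂ hhX hu₂X hX ξ' h𝓔)
      (fun 𝓔 h𝓔 => by
        have := hboth 𝓔 h𝓔
        simpa only [Set.mem_insert_iff, Set.mem_singleton_iff, forall_eq_or_imp, forall_eq,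
          and_assoc] using this) h𝓔
    simpa only [Set.mem_insert_iff, Set.mem_empty_iff_false, or_false, forall_eq,
      Set.mem_singleton_iff] using h2

end Two

end LocRows

end Summit.Ventures.PercRepro2
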